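import Literature.Probability.Percolation.SeedLemma
import Literature.Probability.Percolation.RegionGluing
import Literature.Probability.Percolation.CriticalContinuityProofs
import HarnessLib

/-!
# Rich touching is free: at `p_c` the infinite cluster leaves every lower half-space richly

Seat `solo-CriticalPhenomena-blind` (generation 5), toward `PercolationContinuityZ3`
(`θ(p_c) = 0` for bond percolation on `ℤ³`).

For a level `L ≥ 0` let `K_L(ω)` be the open cluster of the origin INSIDE the lower half-space
`{y₀ ≤ L}` (`lowerCluster`) and let the **touch set** `Z_L(ω) = K_L(ω) ∩ {y₀ = L}` (`touch`) be
the set of its vertices on the boundary plane.  By Barsky–Grimmett–Newman (tree: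
`RegionGluing.ae_forall_not_percolatesVia_coordHalfSpace`, Grimmett 1999 Thm. (7.35)) every `K_L`
is finite `P_{p_c}`-a.s.; so IF the origin lies in an infinite open cluster at `p_c`, that
cluster leaves `{y₀ ≤ L}` through an open edge going up from a vertex of `Z_L`, for EVERY `L`.

* `prob_fewTouch_le` — finite energy, for every `p` and `L ≥ 0`:
  `(1 - p)^{6M} · P_p(1 ≤ |Z_L| ≤ M) ≤ P_p(Z_L ≠ ∅, Z_{L+1} = ∅)` (close the `≤ 6M` lattice
  edges leaving `{y₀ ≤ L}` from `Z_L`; tree `bondPercolation_real_finiteEnergy`, the device of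
  Grimmett 1999 §7.2 (7.16)).
* `pairwise_disjoint_lastTouch`, `tendsto_prob_fewTouch` — the events `{Z_L ≠ ∅, Z_{L+1} = ∅}`
  are pairwise disjoint, hence `P_p(1 ≤ |Z_L| ≤ M) → 0` as `L → ∞` for every `p < 1` and `M`.
* **`tendsto_prob_percolatesAt_inter_smallTouch`** — at `p = p_c(ℤ³)`, for every `M`:
  `P_{p_c}(0 ↔ ∞ and |Z_L| ≤ M) → 0` as `L → ∞`.

Reading.  If `θ(p_c) > 0`, then given `{0 ↔ ∞}` the touch sets escape every bounded size:
"rich touching" of every plane by the lower cluster is automatic, so no contradiction can come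
from the SIZE of the seed the infinite cluster presents to the fresh upper half-space; a proof of
`θ(p_c) = 0` along these lines must control the CONTINUATION from a large spread-out seed at `p_c`.
-/

noncomputable section

namespace Summit.CriticalPhenomena.PercolationContinuityZ3.Theorems.SoloBlindRichTouching

open MeasureTheory Filter Topology ProbabilityTheory
open Literature.Probability.Percolation Literature.Probability.LatticeModels

/-! ### The lower half-spaces, the lower cluster and the touch set -/

/-- The lower half-space `{y | y₀ ≤ L}`. -/
def lowerHalf (L : ℤ) : Set (Site 3) := {y : Site 3 | y 0 ≤ L}

/-- The steps of `ℤ³` inside `{y₀ ≤ L}`. -/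
abbrev lowerGraph (L : ℤ) : SimpleGraph (Site 3) := withinGraph (zdGraph 3) (lowerHalf L)

/-- `K_L(ω)`: the open cluster of the origin inside `{y₀ ≤ L}`. -/
def lowerCluster (L : ℤ) (ω : BondConfig (Site 3)) : Set (Site 3) :=
  openClusterIn (lowerGraph L) ω 0

/-- `Z_L(ω)`: the touch set — the vertices of `K_L(ω)` on the plane `{y₀ = L}`. -/
def touch (L : ℤ) (ω : BondConfig (Site 3)) : Set (Site 3) :=
  {z : Site 3 | z 0 = L ∧ z ∈ lowerCluster L ω}

/-- The origin lies below every level `L ≥ 0`. -/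
theorem zero_mem_lowerHalf {L : ℤ} (hL : 0 ≤ L) : (0 : Site 3) ∈ lowerHalf L := by
  simpa [lowerHalf] using hL

/-- Membership in the touch set. -/
theorem mem_touch {L : ℤ} {ω : BondConfig (Site 3)} {z : Site 3} :
    z ∈ touch L ω ↔ z 0 = L ∧ z ∈ lowerCluster L ω := Iff.rfl

/-- The touch set only depends on the edges inside `{y₀ ≤ L}`. -/
theorem touch_inter_edgeSet (L : ℤ) (ω : BondConfig (Site 3)) :
    touch L (ω ∩ (lowerGraph L).edgeSet) = touch L ω := by
  simp only [touch, lowerCluster, openClusterIn_inter_edgeSet]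

/-- Configurations agreeing inside `{y₀ ≤ L}` have the same touch set. -/
theorem touch_congr {L : ℤ} {ω ω' : BondConfig (Site 3)}
    (h : ω ∩ (lowerGraph L).edgeSet = ω' ∩ (lowerGraph L).edgeSet) :
    touch L ω = touch L ω' := by
  rw [← touch_inter_edgeSet L ω, h, touch_inter_edgeSet]

/-- Any event defined through the touch set is determined by the edges inside `{y₀ ≤ L}`. -/
theorem determinedBy_touch (L : ℤ) (Q : Set (Site 3) → Prop) :
    DeterminedBy {ω : BondConfig (Site 3) | Q (touch L ω)} (lowerGraph L).edgeSet := by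
  rw [determinedBy_iff]
  intro ω ω' h
  simp only [Set.mem_setOf_eq, touch_congr h]

/-- `{z ∈ Z_L}` as a constrained connection event. -/
theorem setOf_mem_touch (L : ℤ) (z : Site 3) :
    {ω : BondConfig (Site 3) | z ∈ touch L ω} =
      if z 0 = L then openConnVia (lowerGraph L) 0 z else ∅ := by
  ext ω
  split_ifs with h
  · simp [mem_touch, lowerCluster, openConnVia, h]
  · simp [mem_touch, h]

/-- `{z ∈ Z_L}` is measurable. -/
theorem measurableSet_mem_touch (L : ℤ) (z : Site 3) :
    MeasurableSet {ω : BondConfig (Site 3) | z ∈ touch L ω} := by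
  rw [setOf_mem_touch]
  split_ifs
  · exact measurableSet_openConnVia _ _ _
  · exact MeasurableSet.empty

/-- `{Z_L = A}` is measurable. -/
theorem measurableSet_touch_eq (L : ℤ) (A : Set (Site 3)) :
    MeasurableSet {ω : BondConfig (Site 3) | touch L ω = A} := by
  have hA : {ω : BondConfig (Site 3) | touch L ω = A} =
      ⋂ z : Site 3, {ω | z ∈ touch L ω ↔ z ∈ A} := by
    ext ω
    simp only [Set.mem_setOf_eq, Set.mem_iInter, Set.ext_iff]
  rw [hA]
  refine MeasurableSet.iInter fun z => ?_
  by_cases hz : z ∈ A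
  · simpa [hz] using measurableSet_mem_touch L z
  · simpa [hz, Set.compl_setOf] using (measurableSet_mem_touch L z).compl

/-- Events of a FINITE touch set are measurable (countably many values). -/
theorem measurableSet_finite_touch (L : ℤ) (P : Set (Site 3) → Prop) :
    MeasurableSet {ω : BondConfig (Site 3) | (touch L ω).Finite ∧ P (touch L ω)} := by
  have h : {ω : BondConfig (Site 3) | (touch L ω).Finite ∧ P (touch L ω)} =
      ⋃ T : Finset (Site 3), ⋃ (_ : P ↑T), {ω | touch L ω = ↑T} := by
    ext ω
    simp only [Set.mem_setOf_eq, Set.mem_iUnion]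
    constructor
    · rintro ⟨hfin, hP⟩
      refine ⟨hfin.toFinset, ?_, ?_⟩
      · rwa [hfin.coe_toFinset]
      · rw [hfin.coe_toFinset]
    · rintro ⟨T, hP, hT⟩
      exact hT ▸ ⟨T.finite_toSet, hP⟩
  rw [h]
  exact MeasurableSet.iUnion fun T => MeasurableSet.iUnion fun _ => measurableSet_touch_eq L _

/-- `{Z_L ≠ ∅}` is measurable. -/
theorem measurableSet_touch_nonempty (L : ℤ) :
    MeasurableSet {ω : BondConfig (Site 3) | (touch L ω).Nonempty} := by
  have h : {ω : BondConfig (Site 3) | (touch L ω).Nonempty} =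
      ⋃ z : Site 3, {ω | z ∈ touch L ω} := by
    ext ω; simp only [Set.mem_setOf_eq, Set.mem_iUnion, Set.Nonempty]
  rw [h]
  exact MeasurableSet.iUnion fun z => measurableSet_mem_touch L z

/-- Along an open walk all of whose vertices stay in `{y₀ ≤ L}`, the endpoint lies in the lower
cluster of the start (for lattice configurations). -/
theorem reachable_lower_of_support {ω : BondConfig (Site 3)} (hω : ω ⊆ (zdGraph 3).edgeSet)
    (L : ℤ) : ∀ {u v : Site 3} (W : (openGraph ω).Walk u v),
      (∀ x ∈ W.support, x ∈ lowerHalf L) → (openGraph ω ⊓ lowerGraph L).Reachable u v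
  | _, _, SimpleGraph.Walk.nil, _ => SimpleGraph.Reachable.refl _
  | _, _, SimpleGraph.Walk.cons (u := a) (v := b) h W, hs => by
      have ha : a ∈ lowerHalf L := hs a (SimpleGraph.Walk.start_mem_support _)
      have hb : b ∈ lowerHalf L :=
        hs b (by
          rw [SimpleGraph.Walk.support_cons]; exact List.mem_cons_of_mem _ W.start_mem_support)
      have hG : (zdGraph 3).Adj a b :=
        (SimpleGraph.mem_edgeSet _).1 (hω ((openGraph_adj ω a b).1 h).1)
      have hadj : (openGraph ω ⊓ lowerGraph L).Adj a b :=
        (SimpleGraph.inf_adj _ _ _ _).2 ⟨h, withinGraph_adj.2 ⟨hG, ha, hb⟩⟩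
      exact hadj.reachable.trans (reachable_lower_of_support hω L W fun x hx =>
        hs x (by rw [SimpleGraph.Walk.support_cons]; exact List.mem_cons_of_mem _ hx))

/-- **First passage.** A walk from the origin to a vertex above level `L ≥ 0`, along open lattice
edges, leaves `{y₀ ≤ L}` for the first time through an open edge `fg` with `f` in the touch set
`Z_L` and `g` at level `L + 1`. -/
theorem exists_touch_of_walk {ω : BondConfig (Site 3)} {L : ℤ} (hL : 0 ≤ L)
    {H : SimpleGraph (Site 3)}
    (hH : ∀ ⦃a b : Site 3⦄, H.Adj a b → s(a, b) ∈ ω ∧ (zdGraph 3).Adj a b)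
    {v : Site 3} (W : H.Walk 0 v) (hv : v ∉ lowerHalf L) :
    ∃ f ∈ touch L ω, ∃ g : Site 3, (zdGraph 3).Adj f g ∧ L < g 0 ∧ s(f, g) ∈ ω := by
  obtain ⟨f, g, h0, hf, hg, hadj, hr⟩ :=
    GM.exists_exit_of_walk (lowerHalf L) W (zero_mem_lowerHalf hL) hv
  obtain ⟨hfg, hG⟩ := hH hadj
  have hg' : L < g 0 := not_le.1 hg
  have hf' : f 0 ≤ L := hf
  have h1 := (RegionGluing.apply_le_add_one_of_zdGraph_adj hG 0).1
  refine ⟨f, mem_touch.2 ⟨by omega, ?_⟩, g, hG, hg', hfg⟩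
  show f ∈ openClusterIn (lowerGraph L) ω 0
  rw [mem_openClusterIn_iff]
  let φ : H.induce (lowerHalf L) →g (openGraph ω ⊓ lowerGraph L) :=
    { toFun := fun x => x.1
      map_rel' := fun {a b} hab =>
        (SimpleGraph.inf_adj _ _ _ _).2 ⟨(openGraph_adj ω _ _).2 ⟨(hH hab).1, (hH hab).2.ne⟩,
          withinGraph_adj.2 ⟨(hH hab).2, a.2, b.2⟩⟩ }
  exact hr.map φ

/-- Adjacency in `openGraph ω ⊓ lowerGraph L'` is along open lattice edges. -/
theorem inf_lowerGraph_adj {ω : BondConfig (Site 3)} {L' : ℤ} : ∀ ⦃a b : Site 3⦄,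
    (openGraph ω ⊓ lowerGraph L').Adj a b → s(a, b) ∈ ω ∧ (zdGraph 3).Adj a b :=
  fun a b hab =>
    ⟨((openGraph_adj ω a b).1 ((SimpleGraph.inf_adj _ _ _ _).1 hab).1).1,
      (withinGraph_adj.1 ((SimpleGraph.inf_adj _ _ _ _).1 hab).2).1⟩

/-- The touch sets are nested in the sense of non-emptiness: a non-empty touch set at a higher
level forces a non-empty touch set at every lower level `L ≥ 0`. -/
theorem touch_nonempty_mono {ω : BondConfig (Site 3)} {L L' : ℤ} (hL : 0 ≤ L) (hLL' : L ≤ L')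
    (h : (touch L' ω).Nonempty) : (touch L ω).Nonempty := by
  rcases hLL'.eq_or_lt with rfl | hlt
  · exact h
  obtain ⟨z, hz0, hzK⟩ := h
  obtain ⟨W⟩ := mem_openClusterIn_iff.1 hzK
  obtain ⟨f, hf, -⟩ := exists_touch_of_walk hL inf_lowerGraph_adj W (show ¬ z 0 ≤ L by omega)
  exact ⟨f, hf⟩

/-- If every lattice edge leaving `{y₀ ≤ L}` from the touch set `Z_L` is closed, all higher
touch sets are empty. -/
theorem touch_eq_empty_of_closed {ω : BondConfig (Site 3)} {L : ℤ} (hL : 0 ≤ L)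
    (hclosed : ∀ f ∈ touch L ω, ∀ g, (zdGraph 3).Adj f g → L < g 0 → s(f, g) ∉ ω)
    {L' : ℤ} (hLL' : L < L') : touch L' ω = ∅ := by
  refine Set.eq_empty_of_forall_notMem fun z hz => ?_
  obtain ⟨hz0, hzK⟩ := hz
  obtain ⟨W⟩ := mem_openClusterIn_iff.1 hzK
  obtain ⟨f, hf, g, hG, hg, hfg⟩ :=
    exists_touch_of_walk hL inf_lowerGraph_adj W (show ¬ z 0 ≤ L by omega)
  exact hclosed f hf g hG hg hfg

/-- If the origin lies in an infinite open cluster but its lower cluster `K_L` is finite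
(`L ≥ 0`), the touch set `Z_L` is non-empty. -/
theorem touch_nonempty_of_infinite {ω : BondConfig (Site 3)} (hω : ω ⊆ (zdGraph 3).edgeSet)
    {L : ℤ} (hL : 0 ≤ L) (hC : (openCluster ω 0).Infinite) (hK : (lowerCluster L ω).Finite) :
    (touch L ω).Nonempty := by
  classical
  obtain ⟨v, hvC, hvK⟩ : ∃ v ∈ openCluster ω 0, v ∉ lowerCluster L ω := by
    by_contra h; push Not at h; exact hC (hK.subset h)
  obtain ⟨W⟩ := (hvC : (openGraph ω).Reachable 0 v)
  obtain ⟨u, hu, huL⟩ : ∃ u ∈ W.support, u ∉ lowerHalf L := by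
    by_contra h; push Not at h
    exact hvK (mem_openClusterIn_iff.2 (reachable_lower_of_support hω L W h))
  obtain ⟨f, hf, -⟩ := exists_touch_of_walk hL (H := openGraph ω) (fun a b hab =>
    ⟨((openGraph_adj ω a b).1 hab).1, (SimpleGraph.mem_edgeSet _).1
      (hω ((openGraph_adj ω a b).1 hab).1)⟩) (W.takeUntil u hu) huL
  exact ⟨f, hf⟩

/-- `{1 ≤ |Z_L| ≤ M}`. -/
def fewTouch (L : ℤ) (M : ℕ) : Set (BondConfig (Site 3)) :=
  {ω | (touch L ω).Finite ∧ ((touch L ω).Nonempty ∧ (touch L ω).ncard ≤ M)}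

/-- `{|Z_L| ≤ M}` (a finite, possibly empty, touch set). -/
def smallTouch (L : ℤ) (M : ℕ) : Set (BondConfig (Site 3)) :=
  {ω | (touch L ω).Finite ∧ (touch L ω).ncard ≤ M}

/-- `{Z_L ≠ ∅, Z_{L+1} = ∅}`: level `L` is the last level touched. -/
def lastTouch (L : ℤ) : Set (BondConfig (Site 3)) :=
  {ω | (touch L ω).Nonempty ∧ touch (L + 1) ω = ∅}

/-- `fewTouch` is measurable. -/
theorem measurableSet_fewTouch (L : ℤ) (M : ℕ) : MeasurableSet (fewTouch L M) :=
  measurableSet_finite_touch L fun Z => Z.Nonempty ∧ Z.ncard ≤ M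

/-- `smallTouch` is measurable. -/
theorem measurableSet_smallTouch (L : ℤ) (M : ℕ) : MeasurableSet (smallTouch L M) :=
  measurableSet_finite_touch L fun Z => Z.ncard ≤ M

/-- `lastTouch` is measurable. -/
theorem measurableSet_lastTouch (L : ℤ) : MeasurableSet (lastTouch L) :=
  (measurableSet_touch_nonempty L).inter (measurableSet_touch_eq (L + 1) ∅)

/-- The events `{Z_L ≠ ∅ = Z_{L+1}}`, `L ∈ ℕ`, are pairwise disjoint. -/
theorem pairwise_disjoint_lastTouch :
    Pairwise (Function.onFun Disjoint fun n : ℕ => lastTouch (n : ℤ)) := by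
  intro m n hmn
  wlog hlt : m < n generalizing m n
  · exact (this hmn.symm (lt_of_le_of_ne (not_lt.1 hlt) hmn.symm)).symm
  rw [Function.onFun, Set.disjoint_left]
  rintro ω ⟨-, hm⟩ ⟨hn, -⟩
  have h := touch_nonempty_mono (ω := ω) (L := (m : ℤ) + 1) (L' := (n : ℤ)) (by positivity)
    (by exact_mod_cast hlt) hn
  exact Set.not_nonempty_empty (hm ▸ h)

/-- `P_p(Z_L ≠ ∅ = Z_{L+1}) → 0` as `L → ∞` (pairwise disjoint events). -/
theorem tendsto_prob_lastTouch (p : unitInterval) :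
    Tendsto (fun n : ℕ => (bondPercolation (zdGraph 3) p).real (lastTouch (n : ℤ)))
      atTop (𝓝 0) :=
  tendsto_measureReal_of_pairwise_disjoint _ (fun _ => measurableSet_lastTouch _)
    pairwise_disjoint_lastTouch

/-- A finite set as a `Finset` (and `∅` for an infinite one). -/
def finsetOf (Z : Set (Site 3)) : Finset (Site 3) :=
  @dite _ Z.Finite (Classical.dec _) (fun h => h.toFinset) fun _ => ∅

/-- `finsetOf` of a finite set. -/
theorem finsetOf_of_finite {Z : Set (Site 3)} (h : Z.Finite) : finsetOf Z = h.toFinset := by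
  rw [finsetOf, dif_pos h]

/-- The touch set as a `Finset`-valued statistic. -/
def touchFinset (L : ℤ) (ω : BondConfig (Site 3)) : Finset (Site 3) := finsetOf (touch L ω)

/-- The lattice edges leaving `{y₀ ≤ L}` from the vertices of `T`. -/
def exitsUp (L : ℤ) (T : Finset (Site 3)) : Finset (Sym2 (Site 3)) :=
  T.biUnion fun x =>
    (((zdGraph 3).neighborFinset x).filter fun y => L < y 0).image fun y => s(x, y)

/-- Membership in `exitsUp`. -/
theorem mem_exitsUp {L : ℤ} {T : Finset (Site 3)} {e : Sym2 (Site 3)} :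
    e ∈ exitsUp L T ↔ ∃ x ∈ T, ∃ y, (zdGraph 3).Adj x y ∧ L < y 0 ∧ e = s(x, y) := by
  simp only [exitsUp, Finset.mem_biUnion, Finset.mem_image, Finset.mem_filter,
    SimpleGraph.mem_neighborFinset, and_assoc, eq_comm]

/-- At most `6|T|` edges leave `{y₀ ≤ L}` from `T`. -/
theorem card_exitsUp_le (L : ℤ) (T : Finset (Site 3)) :
    (exitsUp L T).card ≤ 2 * 3 * T.card := by
  refine Finset.card_biUnion_le.trans ?_
  rw [mul_comm, ← smul_eq_mul, ← Finset.sum_const]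
  exact Finset.sum_le_sum fun x _ => Finset.card_image_le.trans
    ((Finset.card_filter_le _ _).trans (card_neighborFinset_zdGraph_le x))

/-- Exit edges are not edges inside `{y₀ ≤ L}`. -/
theorem exitsUp_disjoint (L : ℤ) (T : Finset (Site 3)) :
    Disjoint (↑(exitsUp L T) : Set (Sym2 (Site 3))) (lowerGraph L).edgeSet := by
  refine Set.disjoint_left.2 fun e he he' => ?_
  obtain ⟨x, -, y, -, hy, rfl⟩ := mem_exitsUp.1 (Finset.mem_coe.1 he)
  have h2 : y 0 ≤ L := (mem_edgeSet_withinGraph.1 he').2.2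
  omega

/-- **Finite energy**: `(1-p)^{6M} P_p(1 ≤ |Z_L| ≤ M) ≤ P_p(Z_L ≠ ∅, Z_{L+1} = ∅)`, `L ≥ 0`. -/
theorem prob_fewTouch_le {L : ℤ} (hL : 0 ≤ L) (M : ℕ) (p : unitInterval) :
    (1 - (p : ℝ)) ^ (2 * 3 * M) * (bondPercolation (zdGraph 3) p).real (fewTouch L M) ≤
      (bondPercolation (zdGraph 3) p).real (lastTouch L) := by
  classical
  have hAb : ∀ b : Finset (Site 3), fewTouch L M ∩ touchFinset L ⁻¹' {b} =
      {ω | (touch L ω).Finite ∧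
        (((touch L ω).Nonempty ∧ (touch L ω).ncard ≤ M) ∧ finsetOf (touch L ω) = b)} := by
    intro b; ext ω
    simp only [fewTouch, touchFinset, Set.mem_inter_iff, Set.mem_setOf_eq, Set.mem_preimage,
      Set.mem_singleton_iff, and_assoc]
  have hfe := bondPercolation_real_finiteEnergy (zdGraph 3) p (A := fewTouch L M)
    (S := (lowerGraph L).edgeSet) (Ψ := touchFinset L) (φ := exitsUp L) (k := 2 * 3 * M)
    (fun b => hAb b ▸
      determinedBy_touch L fun Z =>
        Z.Finite ∧ ((Z.Nonempty ∧ Z.ncard ≤ M) ∧ finsetOf Z = b))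
    (fun b => hAb b ▸
      measurableSet_finite_touch L fun Z => (Z.Nonempty ∧ Z.ncard ≤ M) ∧ finsetOf Z = b)
    (fun ω _ => exitsUp_disjoint L _)
    (fun ω hω => (card_exitsUp_le L _).trans (Nat.mul_le_mul_left _ (by
      obtain ⟨hfin, -, hM⟩ := hω
      rwa [touchFinset, finsetOf_of_finite hfin, ← Set.ncard_eq_toFinset_card _ hfin])))
  refine hfe.trans (measureReal_mono ?_ (measure_ne_top _ _))
  rintro ω ⟨⟨hfin, hne, -⟩, hclosed⟩
  refine ⟨hne, touch_eq_empty_of_closed hL ?_ (by omega)⟩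
  intro f hf g hG hg hopen
  have hfT : f ∈ touchFinset L ω := by
    rw [touchFinset, finsetOf_of_finite hfin, hfin.mem_toFinset]; exact hf
  exact hclosed _ (mem_exitsUp.2 ⟨f, hfT, g, hG, hg, rfl⟩) hopen

/-- **`P_p(1 ≤ |Z_L| ≤ M) → 0` as `L → ∞`**, for every `p < 1` and every `M`. -/
theorem tendsto_prob_fewTouch (p : unitInterval) (hp : (p : ℝ) < 1) (M : ℕ) :
    Tendsto (fun n : ℕ => (bondPercolation (zdGraph 3) p).real (fewTouch (n : ℤ) M))
      atTop (𝓝 0) := by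
  set μ := bondPercolation (zdGraph 3) p
  have hc : 0 < (1 - (p : ℝ)) ^ (2 * 3 * M) := pow_pos (sub_pos.2 hp) _
  have hbound : ∀ n : ℕ, μ.real (fewTouch (n : ℤ) M) ≤
      ((1 - (p : ℝ)) ^ (2 * 3 * M))⁻¹ * μ.real (lastTouch (n : ℤ)) := fun n => by
    rw [le_inv_mul_iff₀ hc]; exact prob_fewTouch_le (by positivity) M p
  refine squeeze_zero (fun n => measureReal_nonneg) hbound ?_
  simpa using (tendsto_prob_lastTouch p).const_mul ((1 - (p : ℝ)) ^ (2 * 3 * M))⁻¹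

/-! ### At `p_c`: rich touching on the event of percolation -/

/-- `P_{p_c}`-a.s., on `{0 ↔ ∞}` every touch set `Z_L`, `L ≥ 0`, is non-empty (BGN: the lower
clusters are finite). -/
theorem ae_touch_nonempty_of_percolatesAt :
    ∀ᵐ ω ∂(bondPercolation (zdGraph 3) (criticalProbI 3)),
      ω ∈ percolatesAt (0 : Site 3) → ∀ L : ℤ, 0 ≤ L → (touch L ω).Nonempty := by
  have hae : ∀ᵐ ω ∂(bondPercolation (zdGraph 3) (criticalProbI 3)),
      ω ⊆ (zdGraph 3).edgeSet := setBernoulli_ae_subset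
  filter_upwards [hae, RegionGluing.ae_forall_not_percolatesVia_coordHalfSpace] with ω hω hfin
    hperc L hL
  exact touch_nonempty_of_infinite hω hL hperc (Set.not_infinite.1 (hfin 0 L 0).2)

/-- **Rich touching is free.** At `p = p_c(ℤ³)`, for every `M`:
`P_{p_c}(0 ↔ ∞ and |Z_L| ≤ M) → 0` as `L → ∞`, where `Z_L` is the set of vertices on the
plane `{y₀ = L}` of the open cluster of the origin inside `{y₀ ≤ L}`. -/
theorem tendsto_prob_percolatesAt_inter_smallTouch (M : ℕ) :
    Tendsto (fun n : ℕ => (bondPercolation (zdGraph 3) (criticalProbI 3)).real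
      (percolatesAt (0 : Site 3) ∩ smallTouch (n : ℤ) M)) atTop (𝓝 0) := by
  set μ := bondPercolation (zdGraph 3) (criticalProbI 3)
  have hp : ((criticalProbI 3 : unitInterval) : ℝ) < 1 := by
    rw [coe_criticalProbI]; exact criticalProb_zd_lt_one (by norm_num)
  have hle : ∀ n : ℕ, μ.real (percolatesAt (0 : Site 3) ∩ smallTouch (n : ℤ) M) ≤
      μ.real (fewTouch (n : ℤ) M) := by
    refine fun n => ENNReal.toReal_mono (measure_ne_top _ _) (measure_mono_ae ?_)
    filter_upwards [ae_touch_nonempty_of_percolatesAt] with ω hω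
    exact fun ⟨hperc, hfinZ, hM⟩ => ⟨hfinZ, hω hperc (n : ℤ) (by positivity), hM⟩
  exact squeeze_zero (fun n => measureReal_nonneg) hle (tendsto_prob_fewTouch _ hp M)

/-- The same in the language of `θ`, without division: for every `M`,
`P_{p_c}(0 ↔ ∞ and not |Z_L| ≤ M) → θ(p_c)`; i.e. if `θ(p_c) > 0` then
`P_{p_c}(|Z_L| ≤ M | 0 ↔ ∞) → 0`. -/
theorem tendsto_prob_percolatesAt_diff_smallTouch (M : ℕ) :
    Tendsto (fun n : ℕ => (bondPercolation (zdGraph 3) (criticalProbI 3)).real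
      (percolatesAt (0 : Site 3) \ smallTouch (n : ℤ) M)) atTop
      (𝓝 (theta (zdGraph 3) (0 : Site 3) (criticalProbI 3))) := by
  set μ := bondPercolation (zdGraph 3) (criticalProbI 3)
  have hθ : theta (zdGraph 3) (0 : Site 3) (criticalProbI 3) = μ.real (percolatesAt 0) := rfl
  have heq : ∀ n : ℕ, μ.real (percolatesAt (0 : Site 3) \ smallTouch (n : ℤ) M) =
      μ.real (percolatesAt (0 : Site 3)) -
        μ.real (percolatesAt (0 : Site 3) ∩ smallTouch (n : ℤ) M) := fun n => by
    rw [← measureReal_sdiff_add_inter (measurableSet_smallTouch (n : ℤ) M) (measure_ne_top _ _)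
        (s := percolatesAt (0 : Site 3)) (μ := μ)]
    ring
  simp_rw [heq, hθ]
  simpa using (tendsto_const_nhds (x := μ.real (percolatesAt (0 : Site 3)))).sub
    (tendsto_prob_percolatesAt_inter_smallTouch M)

end Summit.CriticalPhenomena.PercolationContinuityZ3.Theorems.SoloBlindRichTouching
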